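import Summits.ResolutionOfSingularities.ResolutionOfSingularities.Theorems.HomologicalConductorNoZenoSplitGaloisTower
import Mathlib.AlgebraicGeometry.Scheme
import HarnessLib

/-!
# Crux `NoZenoR` (stmt-ResolutionOfSingularities-19943), β layer, `stub_L1wCoreF` descent brick for BC-4b hypothesis (T):
# THE GALOIS GROUP IS TRANSITIVE ON `Spec` OF THE RESIDUE-FIELD PUSHOUT

Route `ResolutionOfSingularities/HomologicalConductor`, crux chain W4.4.  OURS (cell res-hironaka, seat res-L0-w44-stub-2,
(L1)-PREP v4 §2 / planner (ρ48), step (T-ring)/(R3) of my 19:14Z split; (R1)/(R2) are res-D-pv-039's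
`…NoZenoSplitGaloisTower.exists_algEquiv_map_eq_of_isPrime`); AI-written, weaker than expert review; nothing here is a
statement of the manuscript under review (Hironaka 2017).  Def-free, fact-free, `--supports 19943 --as helper`.

* **`exists_specMap_pushout_eq`** — let `F ← k₀ → K₀` be a span in `CommRingCat` with `F` a field, identified
  (`k₀ ≅ k`, `K₀ ≅ K`, compatibly with `k₀ → K₀` and `k → K`) with a finite GALOIS extension `K/k`, and let `τ i` be
  endomorphisms of `pushout a b` with `inl ≫ τ i = inl`, `inr ≫ τ i = ū i ≫ inr` for endomorphisms `ū i` of `K₀`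
  realising EVERY `k`-automorphism of `K`.  Then the `Spec (τ i)` act TRANSITIVELY on `Spec (pushout a b)`:
  `pushout a b ≅ F ⊗_k K` (`CommRingCat.isPushout_tensorProduct`, `IsPushout.of_iso`), under which `τ i = id ⊗ σ`, and
  `Gal(K/k)` is transitive on `Spec (F ⊗_k K)` (res-D-pv-039).  This is the hypothesis `htrans` of
  `…NoZenoFibreSymmetry.exists_base_eq_of_transitive` for the fibre of `X ×_S Spec Ŝ → X` over an exceptional point.

References: N. Bourbaki, *Algèbre commutative* V §2 no. 2 Thm. 2 [folklore]; Mathlib `RingTheory/Invariant/Basic`.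
-/

noncomputable section

-- single-problem summit: the doubled namespace component `ResolutionOfSingularities` is forced
set_option linter.dupNamespace false

namespace Summit.ResolutionOfSingularities.ResolutionOfSingularities.Theorems.NoZeno.ExcCount

open CategoryTheory AlgebraicGeometry Limits TensorProduct
open Summit.ResolutionOfSingularities.ResolutionOfSingularities.Theorems.NoZeno.SplittingBase
  (exists_algEquiv_map_eq_of_isPrime)

universe u

/-- `id ⊗ σ` is bijective on `F ⊗_k K` for an automorphism `σ` of `K` (it is the equivalence
`Algebra.TensorProduct.congr refl σ`). [folklore] -/
theorem bijective_tensorMap_id {k K F : Type*} [Field k] [Field K] [Algebra k K] [Field F] [Algebra k F]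
    (σ : K ≃ₐ[k] K) :
    Function.Bijective (Algebra.TensorProduct.map (AlgHom.id F F) (σ : K →ₐ[k] K)) :=
  (Algebra.TensorProduct.congr (AlgEquiv.refl : F ≃ₐ[F] F) σ).bijective

/-- **Transitivity on `Spec` of the residue-field pushout.**  For a span `F ← k₀ → K₀` in `CommRingCat` (`F` a field)
identified through `k₀ ≅ k`, `K₀ ≅ K` (compatibly) with a finite Galois extension `K/k`, and endomorphisms `τ i` of
`pushout a b` with `inl ≫ τ i = inl`, `inr ≫ τ i = ū i ≫ inr` whose `ū i` realise every `k`-automorphism of `K`, the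
`Spec (τ i)` are transitive on `Spec (pushout a b)`. (Bourbaki, Alg. Comm. V §2 no. 2 Thm. 2) [folklore] -/
theorem exists_specMap_pushout_eq {k₀ K₀ : CommRingCat.{u}} {F : Type u} [Field F] (a : k₀ ⟶ CommRingCat.of F)
    (b : k₀ ⟶ K₀) {k K : Type u} [Field k] [Field K] [Algebra k K] [FiniteDimensional k K] [IsGalois k K]
    (ek : k₀ ≅ CommRingCat.of k) (eK : K₀ ≅ CommRingCat.of K)
    (hcompat : b ≫ eK.hom = ek.hom ≫ CommRingCat.ofHom (algebraMap k K))
    {ι : Type*} (ū : ι → (K₀ ⟶ K₀))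
    (hū : ∀ σ : K ≃ₐ[k] K, ∃ i, ū i ≫ eK.hom = eK.hom ≫ CommRingCat.ofHom (σ : K →+* K))
    (τ : ι → (pushout a b ⟶ pushout a b)) (hτ1 : ∀ i, pushout.inl a b ≫ τ i = pushout.inl a b)
    (hτ2 : ∀ i, pushout.inr a b ≫ τ i = ū i ≫ pushout.inr a b) (p q : Spec (pushout a b)) :
    ∃ i, (Spec.map (τ i)).base p = q := by
  classical
  -- `F` as a `k`-algebra through `k ≅ k₀ → F`
  letI : Algebra k F := (ek.inv ≫ a).hom.toAlgebra
  -- `pushout a b ≅ F ⊗[k] K`, compatibly with the two structure maps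
  have h := CommRingCat.isPushout_tensorProduct k F K
  have h' : IsPushout a b (CommRingCat.ofHom (Algebra.TensorProduct.includeLeftRingHom : F →+* F ⊗[k] K))
      (eK.hom ≫ CommRingCat.ofHom
        ((Algebra.TensorProduct.includeRight : K →ₐ[k] F ⊗[k] K).toRingHom : K →+* F ⊗[k] K)) := by
    refine h.of_iso ek.symm (Iso.refl _) eK.symm (Iso.refl _) ?_ ?_ ?_ ?_
    · rw [Iso.refl_hom, Category.comp_id, Iso.symm_hom]
      rfl
    · rw [Iso.symm_hom, Iso.symm_hom, Iso.eq_inv_comp, ← Category.assoc, ← hcompat, Category.assoc,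
        eK.hom_inv_id, Category.comp_id]
    · simp
    · simp
  let e : CommRingCat.of (F ⊗[k] K) ≅ pushout a b := h'.isoPushout
  have he1 : pushout.inl a b ≫ e.inv = CommRingCat.ofHom Algebra.TensorProduct.includeLeftRingHom :=
    h'.inl_isoPushout_inv
  have he2 : pushout.inr a b ≫ e.inv = eK.hom ≫ CommRingCat.ofHom
      ((Algebra.TensorProduct.includeRight : K →ₐ[k] F ⊗[k] K).toRingHom : K →+* F ⊗[k] K) :=
    h'.inr_isoPushout_inv
  -- transitivity of `Gal(K/k)` on `Spec (F ⊗[k] K)` (res-D-pv-039)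
  set p' : PrimeSpectrum (F ⊗[k] K) := (Spec.map e.hom).base p with hp'
  set q' : PrimeSpectrum (F ⊗[k] K) := (Spec.map e.hom).base q with hq'
  obtain ⟨σ, hσ⟩ := exists_algEquiv_map_eq_of_isPrime (κ := k) (E := K) (F := F) q'.asIdeal p'.asIdeal
  set φ : F ⊗[k] K →ₐ[F] F ⊗[k] K := Algebra.TensorProduct.map (AlgHom.id F F) (σ : K →ₐ[k] K) with hφ
  obtain ⟨i, hi⟩ := hū σ
  refine ⟨i, ?_⟩
  -- under `e`, `τ i` is `φ = id ⊗ σ`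
  have C : τ i ≫ e.inv = e.inv ≫ CommRingCat.ofHom (φ.toRingHom : F ⊗[k] K →+* F ⊗[k] K) := by
    apply pushout.hom_ext
    · rw [← Category.assoc, hτ1, ← Category.assoc, he1, ← CommRingCat.ofHom_comp]
      congr 1
      ext f
      simp [hφ]
    · rw [← Category.assoc, hτ2, Category.assoc, he2, ← Category.assoc, hi]
      simp only [Category.assoc]
      rw [← Category.assoc (pushout.inr a b), he2, Category.assoc, ← CommRingCat.ofHom_comp, ← CommRingCat.ofHom_comp]
      congr 2
  have C' : e.hom ≫ τ i = CommRingCat.ofHom (φ.toRingHom : F ⊗[k] K →+* F ⊗[k] K) ≫ e.hom := by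
    rw [← cancel_mono e.inv, Category.assoc, C, e.hom_inv_id_assoc, Category.assoc, e.hom_inv_id,
      Category.comp_id]
  -- read off on points
  have hinj : Function.Injective (Spec.map e.hom).base := fun z₁ z₂ hz => by
    have h1 : (Spec.map e.inv).base ((Spec.map e.hom).base z₁) = z₁ := by
      rw [← Scheme.Hom.comp_apply, ← Spec.map_comp, e.inv_hom_id, Spec.map_id]; rfl
    have h2 : (Spec.map e.inv).base ((Spec.map e.hom).base z₂) = z₂ := by
      rw [← Scheme.Hom.comp_apply, ← Spec.map_comp, e.inv_hom_id, Spec.map_id]; rfl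
    rw [← h1, ← h2, hz]
  apply hinj
  have hpt : (Spec.map e.hom).base ((Spec.map (τ i)).base p) =
      (Spec.map (CommRingCat.ofHom (φ.toRingHom : F ⊗[k] K →+* F ⊗[k] K))).base p' := by
    rw [hp', ← Scheme.Hom.comp_apply, ← Scheme.Hom.comp_apply, ← Spec.map_comp, ← Spec.map_comp, C']
  rw [hpt, ← hq']
  -- `Spec (id ⊗ σ) p' = q'`, i.e. `(id ⊗ σ)⁻¹ p' = q'` from `p' = (id ⊗ σ) q'`
  change PrimeSpectrum.comap (φ.toRingHom : F ⊗[k] K →+* F ⊗[k] K) p' = q'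
  ext1
  rw [PrimeSpectrum.comap_asIdeal, hσ, hφ]
  exact Ideal.comap_map_of_bijective _ (bijective_tensorMap_id σ)

end Summit.ResolutionOfSingularities.ResolutionOfSingularities.Theorems.NoZeno.ExcCount

end
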